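import Mathlib.NumberTheory.NumberField.Discriminant.Different
import Mathlib.NumberTheory.RamificationInertia.HilbertTheory
import Mathlib.NumberTheory.RamificationInertia.Valuation
import Mathlib.RingTheory.DedekindDomain.Different
import Mathlib.FieldTheory.Galois.Basic
import HarnessLib

/-!
# Dedekind's different theorem: the upper bound `v_P(𝔇) ≤ e - 1 + v_P(e)` (Galois case)

Topic `NumberTheory/NumberFields`. Theorems only (no definitions, no named facts).

For a finite Galois extension `N/ℚ` (resp. `N/K`, `K` a number field) and a non-zero prime `P`
of `𝓞 N` with ramification index `e` over `p = P ∩ ℤ` (resp. `P ∩ 𝓞 K`), the exponent of `P`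
in the different ideal satisfies

  `v_P(𝔇_{N/ℚ}) ≤ e - 1 + v_P(e)`

(`succ_le_ramificationIdx_add_multiplicity_of_pow_dvd_differentIdeal`; the relative different
`𝔇_{N/K}` is treated verbatim alike in the sibling file `DedekindDifferentBoundRelative.lean`),
stated as: `P ^ j ∣ 𝔇 → j + 1 ≤ e + multiplicity P (e)`.
This is the upper bound in **Dedekind's different theorem** (Bombieri–Gubler, *Heights in
Diophantine Geometry*, App. B, Thm. B.2.11: `e - 1 ≤ v_P(𝔇_{L/K}) < e + v_P(e)`; Serre,
*Local Fields*, III §6, Prop. 13 + Remark; Neukirch, *Algebraic Number Theory*, III (2.6)).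
The lower bound `P ^ (e-1) ∣ 𝔇` and the characterisation "`P ∣ 𝔇` iff ramified" are Mathlib's
`pow_sub_one_dvd_differentIdeal` and `dvd_differentIdeal_iff`; the tame case `P ^ e ∤ 𝔇` is
Mathlib's `not_dvd_differentIdeal_of_isCoprime`. What Mathlib lacks, and this file supplies, is
the bound in the *wildly ramified* case; it is the input for Hermite's theorem in the form
"bounded degree + unramified outside `S` ⇒ finitely many fields" (sibling file
`HermiteFiniteness.lean`), hence for every Chevalley–Weil-type finiteness argument
(e.g. Darmon–Granville 1995, §3).

## Proof (a global substitute for the completion argument of the printed sources)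

The printed proofs complete at `P` and use that a totally ramified extension of complete
discrete valuation rings is monogenic, generated by a uniformiser with Eisenstein minimal
polynomial. Mathlib has no "different commutes with completion", so we replace completion by
Hilbert's **inertia field**: let `G = Gal(N/ℚ)`, `I ≤ G` the inertia group of `P`, `E = N^I`,
`C = 𝓞 E`, `𝔭 = P ∩ C`.

1. `[N : E] = |I| = e` (Mathlib `IntermediateField.finrank_fixedField_eq_card`,
   `Ideal.card_inertia_eq_ramificationIdxIn`), and `Gal(N/E)` acts trivially on `𝓞 N / P`, so
   the inertia group of `P` in `Gal(N/E)` is everything and `e(P|𝔭) = [N : E] = e`; by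
   multiplicativity of ramification indices `e(𝔭|p) = 1`, so `𝔭 ∤ 𝔇_{E/ℚ}` (Mathlib
   `not_dvd_differentIdeal_iff`) and, by the tower formula
   `𝔇_{N/ℚ} = 𝔇_{N/E} · 𝔇_{E/ℚ}` (Mathlib
   `differentIdeal_eq_differentIdeal_mul_differentIdeal`), `P ^ j ∣ 𝔇_{N/ℚ}` implies
   `P ^ j ∣ 𝔇_{N/E}`.
2. Let `π ∈ 𝓞 N` be a uniformiser at `P` and `f ∈ C[X]` its minimal polynomial. Every `c ∈ C`
   has `P`-adic valuation `≡ 0 (mod e)` (Mathlib `intValuation_liesOver`), so in a sum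
   `∑_{k<n} c_k π^k` with `n ≤ e` the non-zero terms have pairwise distinct valuations and the
   valuation of the sum is the minimum (`intValuation_term_le_sum`). Applied to a putative
   `E`-linear relation among `1, π, …, π^{e-1}` this shows `deg f = e`, i.e. `N = E(π)`; applied
   to `f'(π) = e π^{e-1} + ∑_{k<e-1} (k+1) a_{k+1} π^k` it gives `v_P(f'(π)) ≤ v_P(e) + e - 1`.
3. Mathlib's `aeval_derivative_mem_differentIdeal` (the conductor–different formula) gives
   `f'(π) ∈ 𝔇_{N/E}`, i.e. `𝔇_{N/E} ∣ (f'(π))`; with 1 and 2, `j ≤ v_P(f'(π)) ≤ e - 1 + v_P(e)`.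

Not here: the sharp bound for non-Galois extensions (for a subfield of a Galois field one gets a
cruder bound by the tower formula, which is all Hermite's theorem needs — see
`HermiteFiniteness.lean`), and the equality `v_P(𝔇) = e - 1` in the tame case (Mathlib).

## References

* [BombieriGubler2006] E. Bombieri, W. Gubler, *Heights in Diophantine Geometry*, CUP 2006,
  App. B.2, Thm. B.2.11 (Dedekind's different theorem), B.2.18 (inertia field).
* [SerreLocalFields1979] J.-P. Serre, *Local Fields*, GTM 67, Ch. III §6 Prop. 13, Ch. I §7.
* [NeukirchANT1999] J. Neukirch, *Algebraic Number Theory*, Ch. III, Thm. (2.6).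
-/

noncomputable section

open IsDedekindDomain NumberField Polynomial WithZero
open scoped IntermediateField

namespace Literature.NumberTheory.NumberFields

/-! ## A valuation lemma and the Eisenstein-type valuation computation -/

/-- A valuation of a finite sum with a *unique* term of maximal valuation equals that maximal
valuation (strict non-archimedean triangle inequality). [folklore] -/
theorem valuation_sum_eq_of_unique_max {R Γ₀ : Type*} [CommRing R]
    [LinearOrderedCommGroupWithZero Γ₀] (v : Valuation R Γ₀) {ι : Type*} (s : Finset ι)
    (t : ι → R) {k₀ : ι} (hk₀ : k₀ ∈ s) (h0 : v (t k₀) ≠ 0)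
    (h : ∀ k ∈ s, k ≠ k₀ → v (t k) < v (t k₀)) : v (∑ k ∈ s, t k) = v (t k₀) := by
  classical
  rw [← Finset.add_sum_erase s t hk₀]
  apply Valuation.map_add_eq_of_lt_left
  apply Valuation.map_sum_lt _ h0
  intro i hi
  exact h i (Finset.mem_of_mem_erase hi) (Finset.ne_of_mem_erase hi)

section Valuations

variable {C B : Type*} [CommRing C] [IsDedekindDomain C] [CommRing B] [IsDedekindDomain B]
  [Algebra C B] [Module.IsTorsionFree C B]
  (v : HeightOneSpectrum C) (w : HeightOneSpectrum B) [w.asIdeal.LiesOver v.asIdeal]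
  {π : B} (hπ : w.intValuation π = exp (-1 : ℤ))

include hπ in
/-- The `P`-adic valuation of a term `c · π ^ k` (`c` in the base Dedekind domain `C`, `π` a
uniformiser at the prime `P` of `B` above `p`): additively it is `e(P|p) · v_p(c) + k`
(Mathlib's `intValuation_liesOver`). [folklore] -/
theorem intValuation_algebraMap_mul_pow {c : C} (hc : c ≠ 0) (k : ℕ) :
    w.intValuation (algebraMap C B c * π ^ k) =
      exp (-((v.asIdeal.ramificationIdx' w.asIdeal *
        multiplicity v.asIdeal (Ideal.span {c}) + k : ℕ) : ℤ)) := by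
  rw [map_mul, map_pow, ← HeightOneSpectrum.intValuation_liesOver v w, hπ,
    v.intValuation_eq_exp_neg_multiplicity hc, ← exp_nsmul, ← exp_nsmul, ← exp_add]
  congr 1
  push_cast
  ring

include hπ in
/-- **Key valuation estimate** (the computation behind the different bound, Bombieri–Gubler
App. B.2 / Serre, *Local Fields*, III §6): in a sum `∑_{k < n} c_k π^k` with coefficients
`c_k ∈ C` and `n ≤ e = e(P|p)`, the non-zero terms have pairwise distinct `P`-adic valuations
(they are `e · v_p(c_k) + k`, distinct modulo `e`), hence every non-zero term has valuation at
most (multiplicatively: at least) that of the whole sum. [folklore] -/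
theorem intValuation_term_le_sum {n : ℕ} (hn : n ≤ v.asIdeal.ramificationIdx' w.asIdeal)
    (c : ℕ → C) {k₁ : ℕ} (hk₁ : k₁ < n) (hc₁ : c k₁ ≠ 0) :
    w.intValuation (algebraMap C B (c k₁) * π ^ k₁) ≤
      w.intValuation (∑ k ∈ Finset.range n, algebraMap C B (c k) * π ^ k) := by
  classical
  set e := v.asIdeal.ramificationIdx' w.asIdeal with he_def
  set t : ℕ → B := fun k => algebraMap C B (c k) * π ^ k with ht
  -- a maximiser of the valuations
  obtain ⟨k₀, hk₀, hmax⟩ := Finset.exists_max_image (Finset.range n)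
    (fun k => w.intValuation (t k)) ⟨k₁, Finset.mem_range.mpr hk₁⟩
  have hk₀n : k₀ < n := Finset.mem_range.mp hk₀
  have ht₁ : w.intValuation (t k₁) ≠ 0 := by
    rw [ht, intValuation_algebraMap_mul_pow v w hπ hc₁]
    exact exp_ne_zero
  have hc₀ : c k₀ ≠ 0 := by
    intro h0
    have := hmax k₁ (Finset.mem_range.mpr hk₁)
    rw [show w.intValuation (t k₀) = 0 by simp [ht, h0]] at this
    exact ht₁ (le_antisymm this zero_le)
  have ht₀ : w.intValuation (t k₀) ≠ 0 := by
    rw [ht, intValuation_algebraMap_mul_pow v w hπ hc₀]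
    exact exp_ne_zero
  have key : w.intValuation (∑ k ∈ Finset.range n, t k) = w.intValuation (t k₀) := by
    refine valuation_sum_eq_of_unique_max w.intValuation (Finset.range n) t hk₀ ht₀ ?_
    intro k hk hkk₀
    have hkn : k < n := Finset.mem_range.mp hk
    refine lt_of_le_of_ne (hmax k hk) fun heq => hkk₀ ?_
    by_cases hck : c k = 0
    · rw [show w.intValuation (t k) = 0 by simp [ht, hck]] at heq
      exact absurd heq.symm ht₀
    rw [ht, intValuation_algebraMap_mul_pow v w hπ hck, intValuation_algebraMap_mul_pow v w hπ hc₀,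
      exp_inj, neg_inj, Nat.cast_inj, ← he_def] at heq
    -- e * m + k = e * m₀ + k₀ with k, k₀ < e
    have h1 := congr_arg (· % e) heq
    rwa [Nat.mul_add_mod, Nat.mul_add_mod, Nat.mod_eq_of_lt (lt_of_lt_of_le hkn hn),
      Nat.mod_eq_of_lt (lt_of_lt_of_le hk₀n hn)] at h1
  rw [key]
  exact hmax k₁ (Finset.mem_range.mpr hk₁)

end Valuations


/-! ## The different bound -/


/-- **Dedekind's different theorem, upper bound — Galois case over `ℚ`.** Let `N/ℚ` be a finite
Galois extension, `P` a non-zero prime of `𝓞 N` with ramification index `e = e(P|p)` over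
`p = P ∩ ℤ`. Then the exponent of `P` in the different `𝔇_{N/ℚ}` is at most
`e - 1 + v_P(e)`: if `P ^ j ∣ 𝔇_{N/ℚ}` then `j + 1 ≤ e + v_P(e)`, where `v_P(e)` is the
multiplicity of `P` in the principal ideal `(e) ⊆ 𝓞 N`. This is the upper half of
Bombieri–Gubler, Thm. B.2.11 ("`e - 1 ≤ v_P(𝔇_{L/K}) < e + v_P(e)`"; also Serre, *Local
Fields*, Ch. III §6, Prop. 13 and Remark; Neukirch, *Algebraic Number Theory*, Ch. III,
Thm. (2.6)), in the Galois case. Proof: see the module docstring (inertia field + Eisenstein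
valuation computation). [cite: BombieriGubler2006, Thm. B.2.11] -/
theorem succ_le_ramificationIdx_add_multiplicity_of_pow_dvd_differentIdeal
    (N : Type*) [Field N] [NumberField N] [IsGalois ℚ N]
    (P : Ideal (𝓞 N)) [P.IsPrime] (hP : P ≠ ⊥) {j : ℕ} (hj : P ^ j ∣ differentIdeal ℤ (𝓞 N)) :
    j + 1 ≤ P.ramificationIdx ℤ +
      multiplicity P (Ideal.span {((P.ramificationIdx ℤ : ℕ) : 𝓞 N)}) := by
  classical
  set e := P.ramificationIdx ℤ with he
  have he0 : e ≠ 0 := (Ideal.ramificationIdx_pos P ℤ).ne'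
  -- Galois group and inertia field
  let G := N ≃ₐ[ℚ] N
  have : IsGaloisGroup G ℤ (𝓞 N) := IsGaloisGroup.of_isFractionRing G ℤ (𝓞 N) ℚ N
  let I : Subgroup G := P.inertia G
  let E : IntermediateField ℚ N := IntermediateField.fixedField I
  let C := 𝓞 E
  have hE : Module.finrank E N = Nat.card I := IntermediateField.finrank_fixedField_eq_card I
  let p : Ideal ℤ := P.under ℤ
  have hIcard : Nat.card I = p.ramificationIdxIn (𝓞 N) :=
    Ideal.card_inertia_eq_ramificationIdxIn (G := G) p P
  have hee := Ideal.ramificationIdxIn_eq_ramificationIdx p P G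
  let H := N ≃ₐ[E] N
  have : IsGaloisGroup H C (𝓞 N) := IsGaloisGroup.of_isFractionRing H C (𝓞 N) E N
  let 𝔭 : Ideal C := P.under C
  have hcardH := Ideal.card_inertia_eq_ramificationIdxIn (G := H) 𝔭 P
  have htop : P.inertia H = ⊤ := by
    rw [eq_top_iff]
    intro τ _
    refine AddSubgroup.mem_inertia.mpr fun x => ?_
    have hτ : τ.restrictScalars ℚ ∈ I := by
      rw [← IntermediateField.fixingSubgroup_fixedField I]
      intro y
      exact τ.commutes y
    exact AddSubgroup.mem_inertia.mp hτ x
  rw [htop, Ideal.ramificationIdxIn_eq_ramificationIdx 𝔭 P H] at hcardH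
  have h1 : Nat.card (⊤ : Subgroup H) = Nat.card H := Nat.card_congr Subgroup.topEquiv.toEquiv
  rw [h1, IsGaloisGroup.card_eq_finrank H E N, hE, hIcard, hee] at hcardH
  -- hcardH : e = P.ramificationIdx C
  -- valuations
  let w : HeightOneSpectrum (𝓞 N) := ⟨P, inferInstance, hP⟩
  obtain ⟨π, hπ⟩ := w.intValuation_exists_uniformizer
  have h𝔭bot : 𝔭 ≠ ⊥ := Ideal.under_ne_bot C hP
  let v : HeightOneSpectrum C := ⟨𝔭, inferInstance, h𝔭bot⟩
  have hvw : w.asIdeal.LiesOver v.asIdeal := inferInstanceAs (P.LiesOver 𝔭)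
  have he' : v.asIdeal.ramificationIdx' w.asIdeal = e :=
    (Ideal.ramificationIdx'_eq_ramificationIdx 𝔭 P h𝔭bot).trans hcardH.symm
  have hπ0 : π ≠ 0 := by
    intro h
    rw [h, map_zero] at hπ
    exact exp_ne_zero hπ.symm
  -- the minimal polynomial of `π` over `C` has degree `e` (`π` generates `N` over `E`)
  have hπint : IsIntegral C π := Algebra.IsIntegral.isIntegral π
  set f := minpoly C π with hf
  have hfm : f.Monic := minpoly.monic hπint
  have hπN : IsIntegral E (π : N) := Algebra.IsIntegral.isIntegral _
  have hfN : minpoly E (π : N) = f.map (algebraMap C E) := by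
    rw [minpoly.isIntegrallyClosed_eq_field_fractions' E (hπint.algebraMap (B := N)), hf,
      minpoly.algebraMap_eq (FaithfulSMul.algebraMap_injective (𝓞 N) N)]
  have hfinrank : Module.finrank E E⟮(π : N)⟯ = f.natDegree := by
    rw [IntermediateField.adjoin.finrank hπN, hfN,
      natDegree_map_eq_of_injective (FaithfulSMul.algebraMap_injective C E)]
  have heN : Module.finrank E N = e := by rw [he, ← hee, ← hIcard, hE]
  have hdeg_le : f.natDegree ≤ e := by
    rw [← hfinrank, ← heN]
    exact Module.finrank_bot_le_finrank_of_isScalarTower E E⟮(π : N)⟯ N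
  -- expansion of `aeval π g` for a polynomial `g` over `C`
  have hexp : ∀ (g : C[X]) (n : ℕ), g.natDegree < n →
      aeval π g = ∑ k ∈ Finset.range n, algebraMap C (𝓞 N) (g.coeff k) * π ^ k := by
    intro g n hn
    rw [aeval_eq_sum_range' hn]
    simp_rw [Algebra.smul_def]
  have hdeg : f.natDegree = e := by
    refine le_antisymm hdeg_le (not_lt.mp fun hlt => ?_)
    have hsum : ∑ k ∈ Finset.range (f.natDegree + 1),
        algebraMap C (𝓞 N) (f.coeff k) * π ^ k = 0 := by
      rw [← hexp f (f.natDegree + 1) (Nat.lt_succ_self _), hf, minpoly.aeval]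
    have key := intValuation_term_le_sum v w hπ (n := f.natDegree + 1)
      (by rw [he']; exact hlt) (fun k => f.coeff k) (k₁ := f.natDegree) (Nat.lt_succ_self _)
      (by rw [hfm.coeff_natDegree]; exact one_ne_zero)
    rw [hsum, map_zero, le_zero_iff, hfm.coeff_natDegree, map_one, one_mul, map_pow, hπ,
      ← exp_nsmul] at key
    exact exp_ne_zero key
  have htop' : E⟮(π : N)⟯ = ⊤ :=
    IntermediateField.eq_of_le_of_finrank_eq le_top
      (by rw [hfinrank, hdeg, IntermediateField.finrank_top', heN])
  have hadj : Algebra.adjoin E {(π : N)} = ⊤ := by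
    rw [← IntermediateField.adjoin_simple_toSubalgebra_of_isAlgebraic hπN.isAlgebraic, htop',
      IntermediateField.top_toSubalgebra]
  have hmem : aeval π (derivative f) ∈ differentIdeal C (𝓞 N) :=
    aeval_derivative_mem_differentIdeal C E N π hadj
  -- the derivative, expanded
  have he1 : e - 1 + 1 = e := Nat.sub_add_cancel (Nat.one_le_iff_ne_zero.mpr he0)
  have hder : aeval π (derivative f) =
      ∑ k ∈ Finset.range e, algebraMap C (𝓞 N) (f.coeff (k + 1) * (k + 1 : ℕ)) * π ^ k := by
    rw [hexp (derivative f) e (lt_of_lt_of_le (natDegree_derivative_lt (hdeg ▸ he0)) hdeg.le)]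
    refine Finset.sum_congr rfl fun k _ => ?_
    rw [coeff_derivative]
    push_cast
    ring
  have hcoef : f.coeff (e - 1 + 1) * ((e - 1 : ℕ) + 1 : ℕ) = (e : C) := by
    rw [he1, ← hdeg, hfm.coeff_natDegree, one_mul]
  have hterm := intValuation_term_le_sum v w hπ (n := e) he'.ge
    (fun k => f.coeff (k + 1) * (k + 1 : ℕ)) (k₁ := e - 1) (by omega)
    (by rw [hcoef]; exact_mod_cast he0)
  rw [← hder, hcoef, map_natCast] at hterm
  -- `hterm : w (e * π^(e-1)) ≤ w (f'(π))`
  -- divisibility: reduce to the different over `C`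
  have hjC : P ^ j ∣ differentIdeal C (𝓞 N) := by
    have htower := differentIdeal_eq_differentIdeal_mul_differentIdeal ℤ C (𝓞 N)
    rw [htower] at hj
    refine (Ideal.prime_of_isPrime hP inferInstance).pow_dvd_of_dvd_mul_right j ?_ hj
    intro hdvd
    have h𝔭dvd : 𝔭 ∣ differentIdeal ℤ C := by
      rw [Ideal.dvd_iff_le] at hdvd ⊢
      exact Ideal.map_le_iff_le_comap.mp hdvd
    refine (not_dvd_differentIdeal_iff.mpr ?_) h𝔭dvd
    refine Ideal.ramificationIdx_eq_one_iff.mp ?_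
    have ht := Ideal.ramificationIdx_tower (R := ℤ) 𝔭 P
    rw [← hcardH] at ht
    exact (mul_eq_right₀ he0).mp ht.symm
  have hjf : P ^ j ∣ Ideal.span {aeval π (derivative f)} :=
    hjC.trans (Ideal.dvd_iff_le.mpr ((Ideal.span_singleton_le_iff_mem _).mpr hmem))
  have hwj : w.intValuation (aeval π (derivative f)) ≤ exp (-(j : ℤ)) :=
    (w.intValuation_le_pow_iff_dvd _ j).mpr hjf
  -- conclusion
  have hfin := hterm.trans hwj
  have he0' : ((e : ℕ) : 𝓞 N) ≠ 0 := by exact_mod_cast he0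
  rw [map_mul, map_pow, hπ, w.intValuation_eq_exp_neg_multiplicity he0', ← exp_nsmul, ← exp_add,
    exp_le_exp] at hfin
  simp only [smul_neg, nsmul_eq_mul, mul_one] at hfin
  have hPw : multiplicity w.asIdeal (Ideal.span {((e : ℕ) : 𝓞 N)}) =
      multiplicity P (Ideal.span {((e : ℕ) : 𝓞 N)}) := rfl
  rw [hPw] at hfin
  change j + 1 ≤ e + multiplicity P (Ideal.span {((e : ℕ) : 𝓞 N)})
  clear_value e
  omega



end Literature.NumberTheory.NumberFields
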